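import Summits.BirchSwinnertonDyer.Rank1Residual.X11b.Three.GoodReductionSubgroupReductionMapH1
import Mathlib.FieldTheory.Finite.Basic
import HarnessLib

/-!
# X11b at `p = 3` (team N8/O2), JET3-KUMMER (α): Hilbert 90 in cyclic form with the TORUS sign,
# and the fixed points of `x ↦ x^{#k}` in an extension of a finite field `k`

HONEST FRAMING (cell `b2b-bsdres`, run/shared/lean/b2b/bsd-rank1-residual/, verbatim in every
file): the goal of the cell is to DELETE the COMBINATION-SHAPED residual classes of the
Birch–Swinnerton-Dyer formula for ALL analytic-rank `≤ 1` elliptic curves over `ℚ` — "full BSD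
formula for every rank `≤ 1` curve in class `C`" assembled STRICTLY from published theorems — so
that the rank-`≤ 1` remainder becomes exactly the CONSTRUCTION-SHAPED classes, which are TYPED
(missing-input `Prop`s), NOT attempted. This is not "finishing BSD". Team N8/O2 = `x11b3`, seat
`b2b-bsdres-x11b3-p3` (GEN 3), LEAD DEAL #6 A6.2 (2) / A6.3 (3), sub-target S15 (ii) "the
non-split node with `[k : k_v]` odd", part 2 of 3 (pure algebra). THEOREMS ONLY: no definition, no named fact, no `sorry`;
nothing is booked; the flag `JET@p|N` is NOT discharged.

## What

Two elementary inputs of `GoodReductionSubgroupNodeH1Nonsplit` (the stub `h1red` at a non-split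
node that stays non-split over the residue field `k`, `#k = qⁿ`, `n` odd, where `Ẽ_ns(k)` is the
norm-one torus of order `qⁿ + 1` on which the Frobenius acts as `u ↦ u^{−q}`):

* §1 `sum_neg_pow_mul_of_odd` — `(Σ_{j<n} (−q)ʲ)(−q − 1) = −(qⁿ + 1)` for `n` odd;
  `exists_sub_smul_eq_of_smul_eq_zero_of_eq_neg`, `cyclicH1_zsmul_of_cyclic_of_eq_neg` —
  x11b3-p4's Hilbert 90 in cyclic form (`GoodReductionSubgroupReductionMapH1` §2: `C = ⟨g⟩` of
  order `N`, `φ_C = a •`, `(Σ_{j<n} aʲ)(a − 1) = N ⇒ H¹(⟨φ_C⟩, C) = 0`) with the OPPOSITE sign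
  `(Σ_{j<n} aʲ)(a − 1) = −N` (apply p4's lemma to `−S`).
* §2 `mem_range_of_pow_card_eq` — in a field `k'` containing the finite field `k` along
  `j : k →+* k'`, an element with `x^{#k} = x` lies in `j(k)` (the `#k` elements of `j(k)` are
  roots of `T^{#k} − T`, which has at most `#k` roots): the fixed field of `Frob_k` is `k`.

References (locators only; no new fact): [cite: SerreLocalFields1979, VIII §4, X §1 (Hilbert 90)]
[cite: SilvermanAEC2009, Exercise 3.5(a) (PDF p. 97)].

## Design

No definitions; plain Mathlib algebra (`geom_sum_mul`, `Polynomial.card_roots'`,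
`FiniteField.pow_card`). Axioms: `propext`, `Classical.choice`, `Quot.sound`.
-/

noncomputable section

open scoped Classical

namespace Summit.BirchSwinnertonDyer.Rank1Residual.X11b.Three.JetchevKummer

/-! ### §1 Hilbert 90 in cyclic form with the torus sign `(Σ_{j<n} aʲ)(a − 1) = −N` -/

section CyclicGroup

/-- The non-split case `a = −q`, `n` ODD: `(Σ_{j<n} (−q)ʲ)(−q − 1) = −(qⁿ + 1)` — minus the
order of the norm-one torus `Ẽ_ns(k) ⊂ k'ˣ` (`#k = qⁿ`) of a node that stays non-split over `k`.
[folklore] -/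
theorem sum_neg_pow_mul_of_odd (q : ℤ) {n : ℕ} (hn : Odd n) :
    (∑ j ∈ Finset.range n, (-q) ^ j) * (-q - 1) = -(q ^ n + 1) := by
  rw [geom_sum_mul, hn.neg_pow]; ring

variable {C : Type*} [AddCommGroup C]

/-- **Hilbert 90 in a finite cyclic group, arithmetic form, opposite sign**: `C = ⟨g⟩` with `g`
of order `N > 0`, `S · (a − 1) = −N`; then `S • c = 0 ⇒ c = (a − 1) • c'` (p4's
`exists_sub_smul_eq_of_smul_eq_zero` with `−S`). Serre, *Local Fields* VIII §4. [folklore] -/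
theorem exists_sub_smul_eq_of_smul_eq_zero_of_eq_neg (g : C)
    (hg : ∀ c : C, c ∈ AddSubgroup.zmultiples g) {N : ℕ} (hN : addOrderOf g = N) (hN0 : 0 < N)
    {a S : ℤ} (hS : S * (a - 1) = -N) (c : C) (hc : S • c = 0) : ∃ c' : C, (a - 1) • c' = c := by
  have hS' : (-S) * (a - 1) = N := by rw [neg_mul, hS, neg_neg]
  exact exists_sub_smul_eq_of_smul_eq_zero g hg hN hN0 hS' c (by rw [neg_smul, hc, neg_zero])

/-- `H¹(⟨φ_C⟩, C) = 0` in cyclic form for `φ_C = a •` on a cyclic group `C = ⟨g⟩` of order `N`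
with `(Σ_{j<n} aʲ)(a − 1) = −N` (the torus sign): every `c` with `Σ_{j<n} φ_Cʲ c = 0` is
`φ_C c' − c'`. Serre, *Local Fields* VIII §4. [folklore] -/
theorem cyclicH1_zsmul_of_cyclic_of_eq_neg (g : C) (hg : ∀ c : C, c ∈ AddSubgroup.zmultiples g)
    {N : ℕ} (hN : addOrderOf g = N) (hN0 : 0 < N) (φC : C →+ C) {a : ℤ}
    (hφC : ∀ c, φC c = a • c) {n : ℕ} (hS : (∑ j ∈ Finset.range n, a ^ j) * (a - 1) = -N)
    (c : C) (hc : ∑ j ∈ Finset.range n, (⇑φC)^[j] c = 0) : ∃ c' : C, φC c' - c' = c := by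
  have hfun : (⇑φC) = fun x : C ↦ a • x := funext hφC
  rw [hfun, sum_iterate_zsmul] at hc
  obtain ⟨c', hc'⟩ := exists_sub_smul_eq_of_smul_eq_zero_of_eq_neg g hg hN hN0 hS c hc
  exact ⟨c', by rw [hφC, ← hc', sub_smul, one_smul]⟩

end CyclicGroup

/-! ### §2 Finite fields: the fixed points of `x ↦ x^{#k}` in an extension `k' ⊇ k` are `k` -/

section FiniteField

variable {k k' : Type*} [Field k] [Fintype k] [Field k'] (j : k →+* k')

/-- In a field `k'` containing the finite field `k` (along `j`), an element fixed by
`x ↦ x^{#k}` comes from `k`: the `#k` elements of `j(k)` are roots of `T^{#k} − T`, which has at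
most `#k` roots. (The fixed field of `Frob_k` on `k̄` is `k`.) [folklore] -/
theorem mem_range_of_pow_card_eq (x : k') (hx : x ^ Fintype.card k = x) : x ∈ Set.range j := by
  have h1 : 1 < Fintype.card k := Fintype.one_lt_card
  set f : Polynomial k' := Polynomial.X ^ Fintype.card k - Polynomial.X with hf
  have hf0 : f ≠ 0 := FiniteField.X_pow_card_sub_X_ne_zero k' h1
  have hdeg : f.natDegree = Fintype.card k := FiniteField.X_pow_card_sub_X_natDegree_eq k' h1
  have hroot : ∀ y : k', y ^ Fintype.card k = y → y ∈ f.roots.toFinset := by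
    intro y hy
    rw [Multiset.mem_toFinset, Polynomial.mem_roots hf0, Polynomial.IsRoot.def, hf,
      Polynomial.eval_sub, Polynomial.eval_pow, Polynomial.eval_X, hy, sub_self]
  have hS : Finset.univ.image j ⊆ f.roots.toFinset := by
    intro y hy
    obtain ⟨t, -, rfl⟩ := Finset.mem_image.mp hy
    exact hroot _ (by rw [← map_pow, FiniteField.pow_card])
  have hle : f.roots.toFinset.card ≤ (Finset.univ.image j).card := by
    rw [Finset.card_image_of_injective _ j.injective, Finset.card_univ, ← hdeg]
    exact (Multiset.toFinset_card_le _).trans (Polynomial.card_roots' f)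
  have hxr := hroot x hx
  rw [← Finset.eq_of_subset_of_card_le hS hle] at hxr
  obtain ⟨t, -, rfl⟩ := Finset.mem_image.mp hxr
  exact ⟨t, rfl⟩

end FiniteField

end Summit.BirchSwinnertonDyer.Rank1Residual.X11b.Three.JetchevKummer

end
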